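import Literature.Analysis.FluidPDE.LeiZhang2011MeanValue
import Literature.Analysis.FluidPDE.LeiZhang2011Setting
import Literature.Analysis.FluidPDE.AxisymWeights
import Literature.Analysis.FluidPDE.SpaceTimeAxisIntegrable
import Literature.Analysis.FluidPDE.KNSSSwirlLiouville
import HarnessLib

/-!
# Lei–Zhang 2011, Theorem 1.4 — the setting of §2 for a swirl on a finite time slab

Analysis/FluidPDE **proofs file** (theorems only: no definitions, no named facts, no `sorry`)
on the discharge path of `Literature.Analysis.FluidPDE.LeiZhang2011_regularity_bmoStream`
(Z. Lei, Q. S. Zhang, J. Funct. Anal. 261 (2011) = arXiv:1011.5066, **Theorem 1.4**). The mean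
value inequality (2.6) of §2 (`LeiZhang2011.meanValue_inequality`, and its `L^{10/3}` variant
`LeiZhang2011.meanValue_inequality_tenThirds`) is stated for "the setting at radius `R`": a
function `F` on `(−R², 0] × ℝ³` with `C²` axisymmetric slices vanishing on the axis, a drift
`b = curl B`, `‖B(s)‖_BMO ≤ C_B` for a.e. `s`, and the equation
`∂ₛF + b·∇F + (2/r)∂ᵣF = ΔF` off the axis in time-integrated form. `LeiZhang2011Final` supplies
this setting from the swirl `Γ` of a bounded *ancient* solution (`bundle_of_swirl_setting`,
hypotheses on all of `(−∞, 0)`). For the proof of Theorem 1.4 the same bookkeeping is needed for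
the swirl of a classical solution on a **finite slab** `[τ − R², τ] × ℝ³` inside an epoch of
regularity (local bound on `Γ` up to a singular time):

* `LeiZhang2011.bundle_of_swirl_setting_slab` — the hypotheses of `bundle_of_swirl_setting`
  restricted to `[τ − R², τ]` (joint continuity of `Γ`, `∇Γ`, `ΔΓ` and of the drift there, the
  stream function for a.e. `t` there, the integrated equation for `τ − R² ≤ s ≤ t ≤ τ`) give the
  setting at radius `R` for `F(s, ·) = Γ(s + τ, ·)`, `s ∈ [−R², 0]` (clamped time shift
  `c(s) = τ + max(−R², min(s, 0))`; otherwise verbatim the proof of `bundle_of_swirl_setting`).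

## References

* Z. Lei, Q. S. Zhang, J. Funct. Anal. 261 (2011) = arXiv:1011.5066, §2 (setting of (2.1)) and
  §4 (proof of Thm. 1.4). [LeiZhang2011]
-/

noncomputable section

open MeasureTheory Set Function Filter Metric intervalIntegral InnerProductSpace
open _root_.Topology
open scoped InnerProductSpace RealInnerProductSpace NNReal ENNReal Laplacian

namespace Literature.Analysis.FluidPDE

namespace LeiZhang2011

open Literature.Analysis.FunctionSpaces

set_option maxHeartbeats 1600000 in
-- one long bookkeeping proof (verbatim the structure of `bundle_of_swirl_setting`)
/-- **The setting at radius `R` with apex `τ` from the swirl on the slab `[τ − R², τ]`.** Let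
`f(t, ·) ∈ C²(ℝ³)` be axisymmetric scalars vanishing on the axis for `t ∈ [τ − R², τ]`, with
`f`, `∇f`, `Δf` and the drift `u` jointly continuous on `[τ − R², τ] × ℝ³`, `‖u‖ ≤ C_u` there,
`u(t) = curl B(t)` a.e. with `‖B(t)‖_BMO ≤ C_B` for a.e. `t ∈ [τ − R², τ]`, and the swirl-type
equation off the axis in time-integrated form for `τ − R² ≤ s ≤ t ≤ τ`. Then
`F(s, x) = f(s + τ, x)` (`s ∈ [−R², 0]`) is in the setting at radius `R` of
`meanValue_inequality` (drift `u(· + τ)`, stream `B(· + τ)`, `N = ΔF − DF[u] − (2/r)∂ᵣF`).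
[cite: LeiZhang2011, §2 (the setting of (2.1)–(2.6), arXiv pp. 5–8)] -/
theorem bundle_of_swirl_setting_slab
    {f : ℝ → EuclideanSpace ℝ (Fin 3) → ℝ} {u : ℝ → EuclideanSpace ℝ (Fin 3) → EuclideanSpace ℝ (Fin 3)}
    {τ R : ℝ} (hR : 0 < R)
    (h1 : ∀ t ∈ Icc (τ - R ^ 2) τ, ContDiff ℝ 2 (f t))
    (hfc : ContinuousOn (fun p : ℝ × EuclideanSpace ℝ (Fin 3) => f p.1 p.2) (Icc (τ - R ^ 2) τ ×ˢ univ))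
    (h2 : ContinuousOn (fun p : ℝ × EuclideanSpace ℝ (Fin 3) => fderiv ℝ (f p.1) p.2)
      (Icc (τ - R ^ 2) τ ×ˢ univ))
    (h3 : ContinuousOn (fun p : ℝ × EuclideanSpace ℝ (Fin 3) => (Δ (f p.1)) p.2)
      (Icc (τ - R ^ 2) τ ×ˢ univ))
    (h4 : ∀ t ∈ Icc (τ - R ^ 2) τ, IsAxisymmetricScalar (f t))
    (h5 : ∀ t ∈ Icc (τ - R ^ 2) τ, ∀ x, cylRadius x = 0 → f t x = 0)
    (h7 : ContinuousOn (uncurry u) (Icc (τ - R ^ 2) τ ×ˢ univ))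
    {Cu : ℝ} (hub : ∀ t ∈ Icc (τ - R ^ 2) τ, ∀ x, ‖u t x‖ ≤ Cu)
    {B : ℝ → EuclideanSpace ℝ (Fin 3) → EuclideanSpace ℝ (Fin 3)} {CB : ℝ≥0}
    (hB : ∀ᵐ t ∂((volume : Measure ℝ).restrict (Icc (τ - R ^ 2) τ)),
      Differentiable ℝ (B t) ∧ curl (B t) =ᵐ[volume] u t ∧ eBMOSeminormVec (B t) ≤ CB)
    (h11 : ∀ x, cylRadius x ≠ 0 → ∀ s t : ℝ, τ - R ^ 2 ≤ s → s ≤ t → t ≤ τ →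
      f t x - f s x = ∫ σ in s..t, ((Δ (f σ)) x - fderiv ℝ (f σ) x (u σ x) -
        2 / cylRadius x * partialDeriv (eR x) (f σ) x)) :
    ∃ (F N : ℝ → EuclideanSpace ℝ (Fin 3) → ℝ)
      (b Bst : ℝ → EuclideanSpace ℝ (Fin 3) → EuclideanSpace ℝ (Fin 3)) (Mb : ℝ),
      (∀ s ∈ Icc (-R ^ 2) 0, ∀ x, F s x = f (s + τ) x) ∧
      (∀ s, ContDiff ℝ 2 (F s)) ∧ (∀ s, IsAxisymmetricScalar (F s)) ∧
      (∀ s x, cylRadius x = 0 → F s x = 0) ∧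
      (∀ s, LocallyIntegrable (b s) volume) ∧
      (∀ᵐ s ∂(volume.restrict (Ioc (-R ^ 2) 0)),
        Differentiable ℝ (Bst s) ∧ curl (Bst s) =ᵐ[volume] b s ∧ eBMOSeminormVec (Bst s) ≤ CB) ∧
      (∀ s x, N s x =
        (Δ (F s)) x - fderiv ℝ (F s) x (b s x) - 2 / cylRadius x * fderiv ℝ (F s) x (eR x)) ∧
      (∀ᵐ x ∂(volume : Measure (EuclideanSpace ℝ (Fin 3))),
        IntervalIntegrable (fun s => N s x) volume (-R ^ 2) 0 ∧
          ∀ s ∈ Icc (-R ^ 2) 0, F s x = F (-R ^ 2) x + ∫ σ in (-R ^ 2)..s, N σ x) ∧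
      (Continuous fun p : ℝ × EuclideanSpace ℝ (Fin 3) => F p.1 p.2) ∧
      (Continuous fun p : ℝ × EuclideanSpace ℝ (Fin 3) => gradient (F p.1) p.2) ∧
      AEStronglyMeasurable (fun p : ℝ × EuclideanSpace ℝ (Fin 3) => N p.1 p.2)
        ((volume.restrict (Ioc (-R ^ 2) 0)).prod volume) ∧
      Integrable (fun p : ℝ × EuclideanSpace ℝ (Fin 3) => N p.1 p.2)
        ((volume.restrict (Ioc (-R ^ 2) 0)).prod (volume.restrict (closedBall 0 R))) ∧
      AEStronglyMeasurable (fun p : ℝ × EuclideanSpace ℝ (Fin 3) => b p.1 p.2)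
        ((volume.restrict (Ioc (-R ^ 2) 0)).prod volume) ∧
      (∀ s, ∀ x ∈ closedBall (0 : EuclideanSpace ℝ (Fin 3)) R, ‖b s x‖ ≤ Mb) := by
  -- the clamped time shift `c(s) = τ + max(−R², min(s, 0)) ∈ [τ − R², τ]`, `c(s) = s + τ` on `[−R², 0]`
  obtain ⟨c, hcdef⟩ : ∃ c : ℝ → ℝ, ∀ s, c s = τ + max (-R ^ 2) (min s 0) := ⟨_, fun _ => rfl⟩
  have hcc : Continuous c := by
    have e : c = fun s => τ + max (-R ^ 2) (min s 0) := funext hcdef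
    rw [e]; exact continuous_const.add (continuous_const.max (continuous_id.min continuous_const))
  have hcJ : ∀ s, c s ∈ Icc (τ - R ^ 2) τ := fun s => by
    have h1' : -R ^ 2 ≤ max (-R ^ 2) (min s 0) := le_max_left _ _
    have h2' : max (-R ^ 2) (min s 0) ≤ 0 := max_le (by nlinarith) (min_le_right _ _)
    rw [hcdef]; constructor <;> linarith
  have hcle : ∀ s ∈ Icc (-R ^ 2) (0 : ℝ), c s = s + τ := fun s hs => by
    rw [hcdef, min_eq_left hs.2, max_eq_right hs.1]; ring
  set S : Set (ℝ × EuclideanSpace ℝ (Fin 3)) := Icc (τ - R ^ 2) τ ×ˢ univ with hS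
  have hcS : ∀ p : ℝ × EuclideanSpace ℝ (Fin 3), (c p.1, p.2) ∈ S := fun p => ⟨hcJ p.1, mem_univ _⟩
  have hcpc : Continuous fun p : ℝ × EuclideanSpace ℝ (Fin 3) => ((c p.1, p.2) : ℝ × EuclideanSpace ℝ (Fin 3)) :=
    (hcc.comp continuous_fst).prodMk continuous_snd
  -- the objects (opaque names with defining equations)
  obtain ⟨F, hFdef⟩ : ∃ F : ℝ → EuclideanSpace ℝ (Fin 3) → ℝ, ∀ s, F s = f (c s) := ⟨_, fun _ => rfl⟩
  obtain ⟨b, hbdef⟩ : ∃ b : ℝ → EuclideanSpace ℝ (Fin 3) → EuclideanSpace ℝ (Fin 3), ∀ s, b s = u (c s) :=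
    ⟨_, fun _ => rfl⟩
  obtain ⟨Bst, hBdef⟩ : ∃ Bst : ℝ → EuclideanSpace ℝ (Fin 3) → EuclideanSpace ℝ (Fin 3), ∀ s, Bst s = B (c s) :=
    ⟨_, fun _ => rfl⟩
  obtain ⟨N, hNdef⟩ : ∃ N : ℝ → EuclideanSpace ℝ (Fin 3) → ℝ, ∀ s x, N s x =
      (Δ (F s)) x - fderiv ℝ (F s) x (b s x) - 2 / cylRadius x * fderiv ℝ (F s) x (eR x) := ⟨_, fun _ _ => rfl⟩
  -- joint continuity of `F`, `∇F`, `ΔF`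
  have hFc : Continuous fun p : ℝ × EuclideanSpace ℝ (Fin 3) => F p.1 p.2 := by
    have e : (fun p : ℝ × EuclideanSpace ℝ (Fin 3) => F p.1 p.2) = fun p => f (c p.1) p.2 :=
      funext fun p => by rw [hFdef]
    have h := hfc.comp_continuous hcpc hcS
    rw [e]; exact h
  have hDFc : Continuous fun p : ℝ × EuclideanSpace ℝ (Fin 3) => fderiv ℝ (F p.1) p.2 := by
    have e : (fun p : ℝ × EuclideanSpace ℝ (Fin 3) => fderiv ℝ (F p.1) p.2) = fun p => fderiv ℝ (f (c p.1)) p.2 :=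
      funext fun p => by rw [hFdef]
    have h := h2.comp_continuous hcpc hcS
    rw [e]; exact h
  have hΔFc : Continuous fun p : ℝ × EuclideanSpace ℝ (Fin 3) => (Δ (F p.1)) p.2 := by
    have e : (fun p : ℝ × EuclideanSpace ℝ (Fin 3) => (Δ (F p.1)) p.2) = fun p => (Δ (f (c p.1))) p.2 :=
      funext fun p => by rw [hFdef]
    have h := h3.comp_continuous hcpc hcS
    rw [e]; exact h
  have hgradFc : Continuous fun p : ℝ × EuclideanSpace ℝ (Fin 3) => gradient (F p.1) p.2 := by
    have : (fun p : ℝ × EuclideanSpace ℝ (Fin 3) => gradient (F p.1) p.2) =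
        fun p => (InnerProductSpace.toDual ℝ (EuclideanSpace ℝ (Fin 3))).symm (fderiv ℝ (F p.1) p.2) := rfl
    rw [this]
    exact (InnerProductSpace.toDual ℝ (EuclideanSpace ℝ (Fin 3))).symm.continuous.comp hDFc
  -- continuity (hence measurability) of the drift, and measurability of `N`
  have hbc : Continuous fun p : ℝ × EuclideanSpace ℝ (Fin 3) => b p.1 p.2 := by
    have e : (fun p : ℝ × EuclideanSpace ℝ (Fin 3) => b p.1 p.2) = fun p => uncurry u (c p.1, p.2) :=
      funext fun p => by rw [hbdef]; rfl
    rw [e]; exact h7.comp_continuous hcpc hcS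
  have hbmeas : Measurable fun p : ℝ × EuclideanSpace ℝ (Fin 3) => b p.1 p.2 := hbc.measurable
  have h8 : ∀ s, Continuous (b s) := fun s =>
    hbc.comp (continuous_const.prodMk continuous_id)
  have hNmeas : Measurable fun p : ℝ × EuclideanSpace ℝ (Fin 3) => N p.1 p.2 := by
    have e : (fun p : ℝ × EuclideanSpace ℝ (Fin 3) => N p.1 p.2) = fun p =>
        (Δ (F p.1)) p.2 - ⟪gradient (F p.1) p.2, b p.1 p.2⟫ -
          2 / cylRadius p.2 * ⟪gradient (F p.1) p.2, eR p.2⟫ := by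
      funext p
      rw [hNdef, inner_gradient_left, inner_gradient_left]
    rw [e]
    refine (hΔFc.measurable.sub (hgradFc.measurable.inner hbmeas)).sub ?_
    exact (measurable_const.div (continuous_cylRadius.measurable.comp measurable_snd)).mul
      (hgradFc.measurable.inner (measurable_eR.comp measurable_snd))
  have hbB : ∀ s, ∀ x ∈ closedBall (0 : EuclideanSpace ℝ (Fin 3)) R, ‖b s x‖ ≤ Cu :=
    fun s x _ => by rw [hbdef]; exact hub _ (hcJ s) x
  have hCu0 : 0 ≤ Cu := (norm_nonneg _).trans (hub τ ⟨by nlinarith, le_rfl⟩ 0)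
  refine ⟨F, N, b, Bst, Cu, fun s hs x => by rw [hFdef, hcle s hs],
    fun s => by rw [hFdef]; exact h1 _ (hcJ s), fun s => by rw [hFdef]; exact h4 _ (hcJ s),
    fun s x hx => by rw [hFdef]; exact h5 _ (hcJ s) x hx,
    fun s => (h8 s).locallyIntegrable, ?_, hNdef, ?_, hFc, hgradFc,
    hNmeas.aestronglyMeasurable, ?_, hbmeas.aestronglyMeasurable, hbB⟩
  · -- ### the stream function, for a.e. shifted time (translation invariance of Lebesgue measure)
    have hB' : ∀ᵐ t ∂(volume : Measure ℝ), t ∈ Icc (τ - R ^ 2) τ →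
        Differentiable ℝ (B t) ∧ curl (B t) =ᵐ[volume] u t ∧ eBMOSeminormVec (B t) ≤ CB :=
      (ae_restrict_iff' measurableSet_Icc).1 hB
    have htr := (measurePreserving_add_right (volume : Measure ℝ) τ).quasiMeasurePreserving.ae hB'
    refine (ae_restrict_iff' measurableSet_Ioc).2 ?_
    filter_upwards [htr] with s hs hsI
    have h := hs (show s + τ ∈ Icc (τ - R ^ 2) τ by constructor <;> linarith [hsI.1, hsI.2])
    rw [hBdef, hbdef, hcle s ⟨hsI.1.le, hsI.2⟩]
    exact h
  · -- ### the integrated equation, for a.e. `x` (off the axis)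
    have hax : ∀ᵐ x ∂(volume : Measure (EuclideanSpace ℝ (Fin 3))), cylRadius x ≠ 0 := by
      have h0 := volume_axis_eq_zero
      rw [ae_iff]
      refine measure_mono_null (fun x hx => ?_) h0
      simp only [mem_setOf_eq, not_not] at hx ⊢
      obtain ⟨hx0, hx1⟩ := (cylRadius_eq_zero_iff x).1 hx
      simp [hx0, hx1]
    filter_upwards [hax] with x hx
    -- the integrand of (5.10) at the point `x`, as a function of the (unshifted) time
    obtain ⟨g, hg⟩ : ∃ g : ℝ → ℝ, ∀ t, g t = (Δ (f t)) x - fderiv ℝ (f t) x (u t x) -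
        2 / cylRadius x * partialDeriv (eR x) (f t) x := ⟨_, fun _ => rfl⟩
    have hNg : ∀ σ, N σ x = g (c σ) := fun σ => by
      rw [hNdef, hg, hFdef, hbdef]; rfl
    -- `σ ↦ N σ x` is measurable and bounded on `[−R², 0]`, hence interval integrable
    have hNxm : Measurable fun σ => N σ x := hNmeas.comp (measurable_id.prodMk measurable_const)
    have hK : IsCompact ((Icc (-R ^ 2) (0 : ℝ)) ×ˢ ({x} : Set (EuclideanSpace ℝ (Fin 3)))) :=
      isCompact_Icc.prod isCompact_singleton
    obtain ⟨A₁, hA₁⟩ := hK.exists_bound_of_continuousOn hΔFc.continuousOn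
    obtain ⟨A₂, hA₂⟩ := hK.exists_bound_of_continuousOn hDFc.continuousOn
    have hR0 : -R ^ 2 ≤ (0 : ℝ) := by nlinarith
    have hA₂0 : 0 ≤ A₂ := (norm_nonneg _).trans (hA₂ (0, x) ⟨⟨hR0, le_rfl⟩, rfl⟩)
    have hNbd : ∀ σ ∈ Icc (-R ^ 2) (0 : ℝ), ‖N σ x‖ ≤ A₁ + A₂ * Cu + 2 / cylRadius x * A₂ := by
      intro σ hσ
      have hp : ((σ, x) : ℝ × EuclideanSpace ℝ (Fin 3)) ∈ Icc (-R ^ 2) (0 : ℝ) ×ˢ ({x} : Set _) := ⟨hσ, rfl⟩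
      have e1 := hA₁ (σ, x) hp
      have e2 := hA₂ (σ, x) hp
      have hr0 : 0 ≤ 2 / cylRadius x := div_nonneg zero_le_two (cylRadius_nonneg x)
      rw [Real.norm_eq_abs, hNdef]
      calc |(Δ (F σ)) x - fderiv ℝ (F σ) x (b σ x) - 2 / cylRadius x * fderiv ℝ (F σ) x (eR x)|
          ≤ |(Δ (F σ)) x| + |fderiv ℝ (F σ) x (b σ x)| + |2 / cylRadius x * fderiv ℝ (F σ) x (eR x)| := by
            refine (abs_sub _ _).trans (add_le_add ((abs_sub _ _).trans le_rfl) le_rfl)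
        _ ≤ A₁ + A₂ * Cu + 2 / cylRadius x * A₂ := by
            refine add_le_add (add_le_add ((Real.norm_eq_abs _).symm.le.trans e1) ?_) ?_
            · calc |fderiv ℝ (F σ) x (b σ x)| ≤ ‖fderiv ℝ (F σ) x‖ * ‖b σ x‖ := by
                    rw [← Real.norm_eq_abs]; exact ContinuousLinearMap.le_opNorm _ _
                _ ≤ A₂ * Cu := mul_le_mul e2 (by rw [hbdef]; exact hub _ (hcJ σ) x) (norm_nonneg _) hA₂0
            · rw [abs_mul, abs_of_nonneg hr0]
              refine mul_le_mul_of_nonneg_left ?_ hr0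
              calc |fderiv ℝ (F σ) x (eR x)| ≤ ‖fderiv ℝ (F σ) x‖ * ‖eR x‖ := by
                    rw [← Real.norm_eq_abs]; exact ContinuousLinearMap.le_opNorm _ _
                _ ≤ A₂ * 1 := mul_le_mul e2 (norm_eR_le_one x) (norm_nonneg _) hA₂0
                _ = A₂ := mul_one _
    have hNii : IntervalIntegrable (fun σ => N σ x) volume (-R ^ 2) 0 := by
      refine (intervalIntegrable_const (c := A₁ + A₂ * Cu + 2 / cylRadius x * A₂)).mono_fun'
        hNxm.aestronglyMeasurable ?_
      rw [uIoc_of_le hR0]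
      refine (ae_restrict_iff' measurableSet_Ioc).2 (ae_of_all _ fun σ hσ => ?_)
      exact hNbd σ (Ioc_subset_Icc_self hσ)
    refine ⟨hNii, fun s hs => ?_⟩
    -- the identity: shift (5.10) from `[−R² + τ, s + τ]` to `[−R², s]`
    have hs0 : s ≤ 0 := hs.2
    have hident := h11 x hx (-R ^ 2 + τ) (s + τ) (by linarith) (by linarith [hs.1]) (by linarith)
    have eg : (fun t => (Δ (f t)) x - fderiv ℝ (f t) x (u t x) - 2 / cylRadius x * partialDeriv (eR x) (f t) x) = g :=
      funext fun t => (hg t).symm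
    rw [eg] at hident
    have hshift : ∫ σ in (-R ^ 2)..s, N σ x = ∫ t in (-R ^ 2 + τ)..(s + τ), g t := by
      rw [← intervalIntegral.integral_comp_add_right g τ]
      refine intervalIntegral.integral_congr fun σ hσ => ?_
      rw [uIcc_of_le hs.1] at hσ
      show N σ x = g (σ + τ)
      rw [hNg, hcle σ ⟨hσ.1, hσ.2.trans hs0⟩]
    rw [hshift, ← hident, hFdef, hFdef, hcle s ⟨hs.1, hs0⟩, hcle (-R ^ 2) ⟨le_rfl, hR0⟩]
    ring
  · -- ### integrability of `N` on `(−R², 0] × B̄(0, R)` against `1 + 1/r`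
    set K : Set (EuclideanSpace ℝ (Fin 3)) := closedBall 0 R with hK
    have hKc : IsCompact K := isCompact_closedBall _ _
    have hcyl : IsCompact ((Icc (-R ^ 2) (0 : ℝ)) ×ˢ K) := isCompact_Icc.prod hKc
    obtain ⟨A₁, hA₁⟩ := hcyl.exists_bound_of_continuousOn hΔFc.continuousOn
    obtain ⟨A₂, hA₂⟩ := hcyl.exists_bound_of_continuousOn hDFc.continuousOn
    have hR0 : -R ^ 2 ≤ (0 : ℝ) := by nlinarith
    have h0K : (0 : EuclideanSpace ℝ (Fin 3)) ∈ K := mem_closedBall_self hR.le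
    have hA₁0 : 0 ≤ A₁ := (norm_nonneg _).trans (hA₁ (0, 0) ⟨⟨hR0, le_rfl⟩, h0K⟩)
    have hA₂0 : 0 ≤ A₂ := (norm_nonneg _).trans (hA₂ (0, 0) ⟨⟨hR0, le_rfl⟩, h0K⟩)
    have hf'i : Integrable ((univ ×ˢ K : Set (ℝ × EuclideanSpace ℝ (Fin 3))).indicator fun p => N p.1 p.2)
        ((volume.restrict (Ioc (-R ^ 2) 0)).prod volume) := by
      refine integrable_prod_of_le_mul_one_add_inv_cylRadius (K := K) hKc ?_ ?_
        (C := A₁ + A₂ * Cu + 2 * A₂) ?_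
      · exact (hNmeas.indicator (MeasurableSet.univ.prod hKc.measurableSet)).aestronglyMeasurable
      · intro s x hx
        rw [indicator_of_notMem (show (s, x) ∉ (univ ×ˢ K : Set _) from fun h => hx h.2)]
      · intro s hs x hx
        rw [indicator_of_mem (show (s, x) ∈ (univ ×ˢ K : Set _) from ⟨mem_univ _, hx⟩)]
        have hp : ((s, x) : ℝ × EuclideanSpace ℝ (Fin 3)) ∈ Icc (-R ^ 2) (0 : ℝ) ×ˢ K := ⟨Ioc_subset_Icc_self hs, hx⟩
        have e1 := hA₁ (s, x) hp
        have e2 := hA₂ (s, x) hp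
        have hr0 : 0 ≤ (cylRadius x)⁻¹ := inv_nonneg.2 (cylRadius_nonneg x)
        show |N s x| ≤ _
        rw [hNdef]
        calc |(Δ (F s)) x - fderiv ℝ (F s) x (b s x) - 2 / cylRadius x * fderiv ℝ (F s) x (eR x)|
            ≤ |(Δ (F s)) x| + |fderiv ℝ (F s) x (b s x)| + |2 / cylRadius x * fderiv ℝ (F s) x (eR x)| := by
              refine (abs_sub _ _).trans (add_le_add ((abs_sub _ _).trans le_rfl) le_rfl)
          _ ≤ A₁ + A₂ * Cu + 2 * (cylRadius x)⁻¹ * A₂ := by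
              refine add_le_add (add_le_add ((Real.norm_eq_abs _).symm.le.trans e1) ?_) ?_
              · calc |fderiv ℝ (F s) x (b s x)| ≤ ‖fderiv ℝ (F s) x‖ * ‖b s x‖ := by
                      rw [← Real.norm_eq_abs]; exact ContinuousLinearMap.le_opNorm _ _
                  _ ≤ A₂ * Cu := mul_le_mul e2 (by rw [hbdef]; exact hub _ (hcJ s) x) (norm_nonneg _) hA₂0
              · rw [abs_mul, div_eq_mul_inv, abs_of_nonneg (by positivity : (0 : ℝ) ≤ 2 * (cylRadius x)⁻¹)]
                refine mul_le_mul_of_nonneg_left ?_ (by positivity)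
                calc |fderiv ℝ (F s) x (eR x)| ≤ ‖fderiv ℝ (F s) x‖ * ‖eR x‖ := by
                      rw [← Real.norm_eq_abs]; exact ContinuousLinearMap.le_opNorm _ _
                  _ ≤ A₂ * 1 := mul_le_mul e2 (norm_eR_le_one x) (norm_nonneg _) hA₂0
                  _ = A₂ := mul_one _
          _ ≤ (A₁ + A₂ * Cu + 2 * A₂) * (1 + (cylRadius x)⁻¹) := by
              nlinarith [mul_nonneg hA₁0 hr0, mul_nonneg (mul_nonneg hA₂0 hCu0) hr0, hA₂0, hr0]
    -- from `1_K N` on `(−R², 0] × ℝ³` to `N` on `(−R², 0] × K`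
    rw [integrable_indicator_iff (MeasurableSet.univ.prod hKc.measurableSet)] at hf'i
    have hres : (((volume : Measure ℝ).restrict (Ioc (-R ^ 2) 0)).prod
        (volume : Measure (EuclideanSpace ℝ (Fin 3)))).restrict (univ ×ˢ K) =
        (volume.restrict (Ioc (-R ^ 2) 0)).prod (volume.restrict K) := by
      rw [← Measure.restrict_univ (μ := volume.restrict (Ioc (-R ^ 2) (0 : ℝ))), Measure.prod_restrict,
        Measure.restrict_univ]
    rw [IntegrableOn, hres] at hf'i
    exact hf'i


end LeiZhang2011

end Literature.Analysis.FluidPDE
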